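import Literature.Topology.FourManifolds.SliceRibbonIsotopyProofs
import HarnessLib

/-!
# Ribbonness and topological sliceness are invariants of the knot type

Second sibling proof file of `SliceRibbon.lean` (topic `Literature/Topology/FourManifolds`;
D-0014: named facts `def X : Prop` are discharged as `theorem X_holds : X`), after
`SliceRibbonIsotopyProofs.lean` (which discharges `Knot.IsSmoothlySlice.of_isIsotopic` through
proper discs and the neatening theorem). It discharges the two remaining isotopy-invariance
facts of `SliceRibbon.lean`,

* `Literature.Topology.FourManifolds.Knot.IsRibbon.of_isIsotopic_holds` — isotopic knots are
  simultaneously ribbon (Gompf–Stipsicz (1999), §6.2);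
* `Literature.Topology.FourManifolds.Knot.IsTopologicallySlice.of_isIsotopic_holds` — isotopic
  knots are simultaneously topologically slice (Freedman–Quinn (1990), §9.3; Livingston (2005),
  §2),

by transporting discs along the **radial extension** `Φ_F = F.toDiffeotopy.radialExtension`
(`RadialExtension.lean`, Cerf (1968), Ch. I §1, Lemme 2; `AmbientIsotopy.toDiffeotopy`,
`InverseFunctionTheorem.lean`) of an ambient isotopy `F` of `𝕊 3` with `F 1 ∘ K = K'`: a
self-diffeomorphism of `ℝ⁴` which **preserves the norm** and restricts to `F 1` on the unit
sphere. The point, compared with `SliceRibbonIsotopyProofs.lean`, is that no neatening is needed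
(neatening would destroy the Morse data of a ribbon disc): since `‖Φ_F ∘ f‖² = ‖f‖²` as
functions (`Knot.norm_sq_radialExtension_comp`), *every* clause of `Knot.IsSliceDisc` and of
`Knot.IsRibbonDisc` that only involves the radius-squared function — the ball condition,
neatness, nondegeneracy of the interior critical points and absence of interior local maxima —
transfers verbatim from `f` to `Φ_F ∘ f` (`Knot.IsSliceDisc.radialExtension_comp`,
`Knot.IsRibbonDisc.radialExtension_comp`); smoothness, injectivity and immersivity transfer
because `Φ_F` is a diffeomorphism (`injective_fderiv_of_leftInverse`,
`SliceRibbonIsotopyProofs.lean`). For flat discs `G : ℝ² × ℝ² → ℝ⁴`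
(`Knot.IsTopologicallySlice`) one composes with `Φ_F` as a norm-preserving homeomorphism.

## References

* R. E. Gompf, A. I. Stipsicz, *4-Manifolds and Kirby Calculus*, GSM 20 (1999), §6.2 (ribbon
  discs as slice discs without local maxima of the radius). [GompfStipsicz1999]
* M. H. Freedman, F. Quinn, *Topology of 4-manifolds* (1990), §9.3. [FreedmanQuinn1990]
* C. Livingston, *A survey of classical knot concordance*, Handbook of Knot Theory (2005), §2.
  [Livingston2005]
* J. Cerf, *Sur les difféomorphismes de la sphère de dimension trois (Γ₄ = 0)*, LNM 53 (1968),
  Ch. I §1, Lemme 2 (radial extension). [CerfDiffeoSphere1968]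

## Design notes

No statement of another file is modified; no definitions, no notation, no local instances, no
named facts, no `sorry`; `ℝⁿ`, `𝕊 3`, `𝔻²` are spelled out (`EuclideanSpace ℝ (Fin n)`,
`sphere 0 1`, `closedBall 0 1`).
-/

open scoped Manifold ContDiff Topology
open Function Set Metric

noncomputable section

namespace Literature.Topology.FourManifolds

namespace Knot

/-! ## The radial extension of an ambient isotopy of `𝕊 3`, as a diffeomorphism of `ℝ⁴` -/

/-- The radial extension preserves the norm. [folklore] -/
@[simp]
theorem norm_radialExtension
    (F : AmbientIsotopy (𝓡 3) (sphere (0 : EuclideanSpace ℝ (Fin (3 + 1))) 1))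
    (x : EuclideanSpace ℝ (Fin 4)) : ‖F.toDiffeotopy.radialExtension x‖ = ‖x‖ :=
  norm_radialExtensionFun F.toFun x

/-- On the unit sphere the radial extension is the final stage `F 1`. [folklore] -/
theorem radialExtension_coe_sphere
    (F : AmbientIsotopy (𝓡 3) (sphere (0 : EuclideanSpace ℝ (Fin (3 + 1))) 1))
    (z : sphere (0 : EuclideanSpace ℝ (Fin (3 + 1))) 1) :
    F.toDiffeotopy.radialExtension (z : EuclideanSpace ℝ (Fin 4)) =
      (F.toFun 1 z : sphere (0 : EuclideanSpace ℝ (Fin (3 + 1))) 1) :=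
  radialExtensionFun_coe_sphere F.toFun z

/-- The radial extension is `C^∞` as a map of `ℝ⁴`. [folklore] -/
theorem contDiff_radialExtension
    (F : AmbientIsotopy (𝓡 3) (sphere (0 : EuclideanSpace ℝ (Fin (3 + 1))) 1)) :
    ContDiff ℝ ∞ F.toDiffeotopy.radialExtension :=
  contDiff_radialExtensionFun F.contMDiff F.map_zero

/-- The inverse of the radial extension is `C^∞` as a map of `ℝ⁴`. [folklore] -/
theorem contDiff_radialExtension_symm
    (F : AmbientIsotopy (𝓡 3) (sphere (0 : EuclideanSpace ℝ (Fin (3 + 1))) 1)) :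
    ContDiff ℝ ∞ F.toDiffeotopy.radialExtension.symm :=
  contDiff_radialExtensionFun F.toDiffeotopy.contMDiff_uncurry_invFun
    F.toDiffeotopy.invFun_zero

/-- The derivative of the radial extension is injective at every point (it is a diffeomorphism;
`injective_fderiv_of_leftInverse`). [folklore] -/
theorem injective_fderiv_radialExtension
    (F : AmbientIsotopy (𝓡 3) (sphere (0 : EuclideanSpace ℝ (Fin (3 + 1))) 1))
    (y : EuclideanSpace ℝ (Fin 4)) : Injective (fderiv ℝ F.toDiffeotopy.radialExtension y) :=
  injective_fderiv_of_leftInverse ((contDiff_radialExtension F).differentiable (by simp))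
    ((contDiff_radialExtension_symm F).differentiable (by simp))
    F.toDiffeotopy.radialExtension.left_inv y

/-- **The radius-squared function of `Φ_F ∘ f` is that of `f`.** [folklore] -/
theorem norm_sq_radialExtension_comp
    (F : AmbientIsotopy (𝓡 3) (sphere (0 : EuclideanSpace ℝ (Fin (3 + 1))) 1)) {α : Type*}
    (f : α → EuclideanSpace ℝ (Fin 4)) :
    (fun y ↦ ‖(F.toDiffeotopy.radialExtension ∘ f) y‖ ^ 2) = fun y ↦ ‖f y‖ ^ 2 := by
  funext y
  rw [comp_apply, norm_radialExtension]

/-! ## Slice discs and ribbon discs -/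

/-- **The radial extension of an ambient isotopy carries slice discs to slice discs** (all
clauses, including neatness): if `F 1 ∘ K = K'` and `f` is a slice disc of `K`, then `Φ_F ∘ f`
is a slice disc of `K'`. Livingston (2005), §2. [cite: Livingston2005, §2] -/
theorem IsSliceDisc.radialExtension_comp {K K' : Knot}
    {F : AmbientIsotopy (𝓡 3) (sphere (0 : EuclideanSpace ℝ (Fin (3 + 1))) 1)}
    (hF : F.toFun 1 ∘ ⇑K = ⇑K') {f : EuclideanSpace ℝ (Fin 2) → EuclideanSpace ℝ (Fin 4)}
    (hf : K.IsSliceDisc f) : K'.IsSliceDisc (F.toDiffeotopy.radialExtension ∘ f) := by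
  obtain ⟨hsmooth, hinj, himm, hball, hneat, hbdry⟩ := hf
  refine ⟨(contDiff_radialExtension F).comp hsmooth,
    F.toDiffeotopy.radialExtension.injective.comp_injOn hinj, fun x hx ↦ ?_, fun x hx ↦ ?_,
    fun x hx ↦ ?_, fun x ↦ ?_⟩
  · rw [fderiv_comp x (((contDiff_radialExtension F).differentiable (by simp)) (f x))
      ((hsmooth.differentiable (by simp)) x), ContinuousLinearMap.coe_comp]
    exact (injective_fderiv_radialExtension F (f x)).comp (himm x hx)
  · rw [comp_apply, norm_radialExtension]
    exact hball x hx
  · rw [norm_sq_radialExtension_comp]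
    exact hneat x hx
  · rw [comp_apply, hbdry x, radialExtension_coe_sphere,
      ← comp_apply (f := F.toFun 1) (g := ⇑K), hF]

/-- **The radial extension of an ambient isotopy carries ribbon discs to ribbon discs**: the
radius-squared function is unchanged, so its interior critical points, their Hessians and the
absence of local maxima are the same. Gompf–Stipsicz (1999), §6.2.
[cite: GompfStipsicz1999, §6.2] -/
theorem IsRibbonDisc.radialExtension_comp {K K' : Knot}
    {F : AmbientIsotopy (𝓡 3) (sphere (0 : EuclideanSpace ℝ (Fin (3 + 1))) 1)}
    (hF : F.toFun 1 ∘ ⇑K = ⇑K') {f : EuclideanSpace ℝ (Fin 2) → EuclideanSpace ℝ (Fin 4)}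
    (hf : K.IsRibbonDisc f) : K'.IsRibbonDisc (F.toDiffeotopy.radialExtension ∘ f) := by
  obtain ⟨hslice, hmorse⟩ := hf
  refine ⟨hslice.radialExtension_comp hF, ?_⟩
  simp only [norm_sq_radialExtension_comp]
  exact hmorse

/-- **Discharge of the named fact `Knot.IsRibbon.of_isIsotopic`** (`SliceRibbon.lean`): being
ribbon is an invariant of the isotopy class of a knot — compose a ribbon disc with the radial
extension `Φ_F` of the ambient isotopy. Gompf–Stipsicz (1999), §6.2.
[cite: GompfStipsicz1999, §6.2] -/
theorem IsRibbon.of_isIsotopic_holds : IsRibbon.of_isIsotopic := by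
  intro K K' hiso hribbon
  obtain ⟨F, hF⟩ := hiso
  obtain ⟨f, hf⟩ := hribbon
  exact ⟨F.toDiffeotopy.radialExtension ∘ f, hf.radialExtension_comp hF⟩

/-! ## Flat discs -/

/-- **Discharge of the named fact `Knot.IsTopologicallySlice.of_isIsotopic`**
(`SliceRibbon.lean`): topological sliceness is an invariant of the isotopy class of a knot —
compose a flat disc `G : ℝ² × ℝ² → ℝ⁴` with the radial extension `Φ_F`, a norm-preserving
homeomorphism of `ℝ⁴` restricting to `F 1` on `𝕊 3`. Freedman–Quinn (1990), §9.3;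
Livingston (2005), §2. [cite: FreedmanQuinn1990, §9.3] -/
theorem IsTopologicallySlice.of_isIsotopic_holds : IsTopologicallySlice.of_isIsotopic := by
  intro K K' hiso hslice
  obtain ⟨F, hF⟩ := hiso
  obtain ⟨G, hemb, hnorm, hbdry⟩ := hslice
  refine ⟨F.toDiffeotopy.radialExtension ∘ G, ?_, fun x w hx ↦ ?_, fun x ↦ ?_⟩
  · have : (closedBall (0 : EuclideanSpace ℝ (Fin 2)) 1 ×ˢ
          (univ : Set (EuclideanSpace ℝ (Fin 2)))).restrict (F.toDiffeotopy.radialExtension ∘ G) =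
        F.toDiffeotopy.radialExtension ∘ (closedBall (0 : EuclideanSpace ℝ (Fin 2)) 1 ×ˢ
          (univ : Set (EuclideanSpace ℝ (Fin 2)))).restrict G := rfl
    rw [this]
    exact F.toDiffeotopy.radialExtension.toHomeomorph.isEmbedding.comp hemb
  · simp only [comp_apply, norm_radialExtension]
    exact hnorm x w hx
  · rw [comp_apply, hbdry x, radialExtension_coe_sphere,
      ← comp_apply (f := F.toFun 1) (g := ⇑K), hF]

end Knot

end Literature.Topology.FourManifolds
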